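import Mathlib
import Literature.Analysis.FluidPDE.Tao2016AveragedNS.ShiftSetCascadeFlows
import Summits.NavierStokesRegularity.NavierStokesRegularity.Theorems.TaoLadderRungTwoFlatMirrorTableDefs
import Summits.NavierStokesRegularity.NavierStokesRegularity.Theorems.TaoLadderRungTwoFlatMirrorField
import Summits.NavierStokesRegularity.NavierStokesRegularity.Theorems.TaoLadderRungTwoFlatEnergyFluxPointwise
import Summits.NavierStokesRegularity.NavierStokesRegularity.Theorems.TaoLadderRungTwoFlatInterfaceStencil
import HarnessLib

/-!
# Tao ladder, rung 2♭ — the CORE-TRUNCATED DEVIATION solves a FORCED deviation equation (junk race L8b-3, part 1: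
  localisation) (helper for the transfer theorem stmt-NavierStokesRegularity-23909 `GradedAdiabaticWake` and the
  λ₀ = 1 layer stmt-…-23908, children of K_A♭ stmt-…-22987; route TaoLadderRungTwoFlat; cell harvest/h2-tao-ladder,
  p1 g21; LADDER §49.5 (b), lemma L8b-3)

theory-1 g37: p1 g20's linear ⇒ nonlinear hop estimate (`QuadPolar.nonlinear_hop_estimate`) carries a quadratic
remainder in the GLOBAL head-gauge norm of the deviation `u = X − W`, which behind a captured pulse is the junk
amplitude (O(1)) — useless there. The fix is to run the core-zone estimate on the TRUNCATED deviation
`η = truncFam e u := u·1_{k ≥ e+1}` (shells ahead of the edge shell `e`), which vanishes behind, and to let the behind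
zone enter only as a FORCING at the interface. This file proves that `η` solves
  `η̇ᵢ,ₖ = Qᵢ,ₖ(W + η) − Qᵢ,ₖ(W) + fᵢ,ₖ`,   `f = interfaceForcing ε ε₀ e W u`,
EXACTLY, for the graded mirror lattice, where the forcing is supported on the two sites `(0, e+1)` (the behind
deviation `q_e` pushing the core carrier) and `(1, e)` (bookkeeping: the truncated family is frozen at the bond of
shell `e` although the core carrier `p_{e+1}` acts on it), with
  `f₀,ₑ₊₁ = c_e·q_e·(2V_e + q_e + ε(A_{e+1} + p_{e+1}))`,   `f₁,ₑ = c_e·p_{e+1}·(V_e + ε(2A_{e+1} + p_{e+1}))`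
(`W = (A,V)`, `u = (p,q)`): both FIRST ORDER in (template amplitude at the edge, deviations at the interface).

* `truncFam`, `interfaceForcing` — the two objects (definitions);
* `truncFam_of_le`, `truncFam_of_gt`, `interfaceForcing_eq_zero` — support facts;
* `hasDerivAt_truncFam` — the forced deviation equation, all sites;
* `abs_interfaceForcing_carrier_le`, `abs_interfaceForcing_bond_le` — the first-order bounds;
* `continuous_interfaceForcing` — continuity (for the Duhamel–Gronwall lemmas of `…GaugeGronwall`).

HONEST FRAMING: finite algebra/calculus about a MODEL lattice (Tao 2016 §4 vocabulary on `S♭`), kernel-checked;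
nothing certified about any orbit; nothing about the Navier–Stokes equations.
-/

noncomputable section

-- the sub-problem namespace repeats the summit name by design (D-0017)
set_option linter.dupNamespace false

namespace Summit.NavierStokesRegularity.NavierStokesRegularity.Theorems

open Literature.Analysis.FluidPDE Literature.Analysis.FluidPDE.TaoCascade

namespace MirrorPulse

/-! ### 1. The objects -/

/-- The CORE TRUNCATION of a family at the edge shell `e`: keep shells `k ≥ e+1`, zero out shells `k ≤ e`.
[cite: Tao2016AveragedNS, §4 (4.8); route TaoLadderRungTwoFlat, posited object (L8b-3 localisation)] -/
def truncFam (e : ℤ) (u : Fin 2 → ℤ → ℝ → ℝ) : Fin 2 → ℤ → ℝ → ℝ :=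
  fun i k t => if e + 1 ≤ k then u i k t else 0

/-- The INTERFACE FORCING of the truncated deviation equation at the edge shell `e` (template `W = (A,V)`, deviation
`u = (p,q)`, clocks `c_n = (1+ε₀)^{5n/2}`): `f₀,ₑ₊₁ = c_e·q_e·(2V_e + q_e + ε(A_{e+1} + p_{e+1}))`,
`f₁,ₑ = c_e·p_{e+1}·(V_e + ε(2A_{e+1} + p_{e+1}))`, zero elsewhere.
[cite: Tao2016AveragedNS, §4 (4.8); route TaoLadderRungTwoFlat, posited object (L8b-3 localisation)] -/
def interfaceForcing (ε ε₀ : ℝ) (e : ℤ) (W u : Fin 2 → ℤ → ℝ → ℝ) : Fin 2 → ℤ → ℝ → ℝ :=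
  fun i k t =>
    if i = 0 ∧ k = e + 1 then
      clock ε₀ e * u 1 e t * (2 * W 1 e t + u 1 e t + ε * (W 0 (e + 1) t + u 0 (e + 1) t))
    else if i = 1 ∧ k = e then
      clock ε₀ e * u 0 (e + 1) t * (W 1 e t + ε * (2 * W 0 (e + 1) t + u 0 (e + 1) t))
    else 0

/-! ### 2. Support facts -/

/-- Ahead of the edge the truncation is the family. [cite: Tao2016AveragedNS, §4 (4.8); route TaoLadderRungTwoFlat, L8b-3] -/
theorem truncFam_of_le {e k : ℤ} (hk : e + 1 ≤ k) (u : Fin 2 → ℤ → ℝ → ℝ) (i : Fin 2) :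
    truncFam e u i k = u i k := by
  funext t; simp [truncFam, hk]

/-- Behind the edge (inclusive) the truncation vanishes. [cite: Tao2016AveragedNS, §4 (4.8); route TaoLadderRungTwoFlat, L8b-3] -/
theorem truncFam_of_gt {e k : ℤ} (hk : k ≤ e) (u : Fin 2 → ℤ → ℝ → ℝ) (i : Fin 2) :
    truncFam e u i k = fun _ => 0 := by
  funext t
  have : ¬ (e + 1 ≤ k) := by omega
  simp [truncFam, this]

/-- `W + truncFam e u` agrees with `W + u` at every site of shells `≥ e+1`.
[cite: Tao2016AveragedNS, §4 (4.8); route TaoLadderRungTwoFlat, L8b-3] -/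
theorem add_truncFam_eqOn_core (e : ℤ) (W u : Fin 2 → ℤ → ℝ → ℝ) (t : ℝ) :
    ∀ i, ∀ k, e + 1 ≤ k → (W + u) i k t = (W + truncFam e u) i k t := by
  intro i k hk
  simp [Pi.add_apply, truncFam, hk]

/-- The interface forcing vanishes off the two sites `(0, e+1)`, `(1, e)`.
[cite: Tao2016AveragedNS, §4 (4.8); route TaoLadderRungTwoFlat, L8b-3] -/
theorem interfaceForcing_eq_zero (ε ε₀ : ℝ) {e : ℤ} (W u : Fin 2 → ℤ → ℝ → ℝ) {i : Fin 2} {k : ℤ}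
    (h : ¬ (i = 0 ∧ k = e + 1)) (h' : ¬ (i = 1 ∧ k = e)) (t : ℝ) : interfaceForcing ε ε₀ e W u i k t = 0 := by
  simp [interfaceForcing, h, h']

/-- The carrier interface value. [cite: Tao2016AveragedNS, §4 (4.8); route TaoLadderRungTwoFlat, L8b-3] -/
theorem interfaceForcing_carrier (ε ε₀ : ℝ) (e : ℤ) (W u : Fin 2 → ℤ → ℝ → ℝ) (t : ℝ) :
    interfaceForcing ε ε₀ e W u 0 (e + 1) t
      = clock ε₀ e * u 1 e t * (2 * W 1 e t + u 1 e t + ε * (W 0 (e + 1) t + u 0 (e + 1) t)) := by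
  simp [interfaceForcing]

/-- The bond bookkeeping value. [cite: Tao2016AveragedNS, §4 (4.8); route TaoLadderRungTwoFlat, L8b-3] -/
theorem interfaceForcing_bond (ε ε₀ : ℝ) (e : ℤ) (W u : Fin 2 → ℤ → ℝ → ℝ) (t : ℝ) :
    interfaceForcing ε ε₀ e W u 1 e t
      = clock ε₀ e * u 0 (e + 1) t * (W 1 e t + ε * (2 * W 0 (e + 1) t + u 0 (e + 1) t)) := by
  have h : ¬ ((1 : Fin 2) = 0 ∧ e = e + 1) := by simp
  simp [interfaceForcing]

/-! ### 3. The forced deviation equation -/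

/-- **THE CORE-TRUNCATED DEVIATION SOLVES THE FORCED DEVIATION EQUATION.** If `W` and `X = W + u` both solve the
graded mirror lattice at time `t` (every site), then for every site `(i,k)` the truncation `η = truncFam e u` has
`η̇ᵢ,ₖ(t) = Qᵢ,ₖ(W + η)(t) − Qᵢ,ₖ(W)(t) + interfaceForcingᵢ,ₖ(t)`.
[cite: Tao2016AveragedNS, §4 (4.8); route TaoLadderRungTwoFlat, L8b-3 (LADDER §49.5 (b))] -/
theorem hasDerivAt_truncFam {ε ε₀ : ℝ} {W u : Fin 2 → ℤ → ℝ → ℝ} {e : ℤ} {t : ℝ}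
    (hW : ∀ i k, HasDerivAt (W i k) (quadTermOn shiftSetFlat ε₀ (mirrorTable ε ε) W i k t) t)
    (hX : ∀ i k, HasDerivAt ((W + u) i k) (quadTermOn shiftSetFlat ε₀ (mirrorTable ε ε) (W + u) i k t) t)
    (i : Fin 2) (k : ℤ) :
    HasDerivAt (truncFam e u i k)
      (quadTermOn shiftSetFlat ε₀ (mirrorTable ε ε) (W + truncFam e u) i k t
        - quadTermOn shiftSetFlat ε₀ (mirrorTable ε ε) W i k t
        + interfaceForcing ε ε₀ e W u i k t) t := by
  have hagree := add_truncFam_eqOn_core e W u t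
  -- values of the truncated family at the shells around the edge
  have hη_e : ∀ j, (W + truncFam e u) j e t = W j e t := fun j => by
    simp [Pi.add_apply, truncFam]
  have hη_em : ∀ j, (W + truncFam e u) j (e - 1) t = W j (e - 1) t := fun j => by
    have : ¬ (e + 1 ≤ e - 1) := by omega
    simp [Pi.add_apply, truncFam, this]
  have hη_ep : ∀ j, (W + truncFam e u) j (e + 1) t = W j (e + 1) t + u j (e + 1) t := fun j => by
    simp [Pi.add_apply, truncFam]
  rcases lt_trichotomy k e with hlt | heq | hgt
  · ----------------------------------------------------------------
    -- k ≤ e − 1: nothing of η is read; derivative of 0 is 0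
    ----------------------------------------------------------------
    rw [truncFam_of_gt (by omega : k ≤ e)]
    have hQ : quadTermOn shiftSetFlat ε₀ (mirrorTable ε ε) (W + truncFam e u) i k t
        = quadTermOn shiftSetFlat ε₀ (mirrorTable ε ε) W i k t := by
      have h1 : ∀ j, (W + truncFam e u) j (k - 1) t = W j (k - 1) t := fun j => by
        have : ¬ (e + 1 ≤ k - 1) := by omega
        simp [Pi.add_apply, truncFam, this]
      have h2 : ∀ j, (W + truncFam e u) j k t = W j k t := fun j => by
        have : ¬ (e + 1 ≤ k) := by omega
        simp [Pi.add_apply, truncFam, this]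
      have h3 : ∀ j, (W + truncFam e u) j (k + 1) t = W j (k + 1) t := fun j => by
        have : ¬ (e + 1 ≤ k + 1) := by omega
        simp [Pi.add_apply, truncFam, this]
      fin_cases i
      · simp only [Fin.zero_eta, Fin.isValue, MirrorField.quadTermOn_mirrorTable_carrier, h1, h2]
      · simp only [Fin.mk_one, Fin.isValue, MirrorField.quadTermOn_mirrorTable_bond, h2, h3]
    have hf : interfaceForcing ε ε₀ e W u i k t = 0 :=
      interfaceForcing_eq_zero ε ε₀ W u (by omega) (by omega) t
    rw [hQ, hf, sub_self, zero_add]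
    exact hasDerivAt_const t 0
  · ----------------------------------------------------------------
    -- k = e: the carrier reads shells e−1, e (nothing); the bond reads e, e+1 (bookkeeping site)
    ----------------------------------------------------------------
    subst heq
    rw [truncFam_of_gt le_rfl]
    fin_cases i
    · have hQ : quadTermOn shiftSetFlat ε₀ (mirrorTable ε ε) (W + truncFam k u) 0 k t
          = quadTermOn shiftSetFlat ε₀ (mirrorTable ε ε) W 0 k t := by
        simp only [Fin.isValue, MirrorField.quadTermOn_mirrorTable_carrier, hη_e, hη_em]
      have hf : interfaceForcing ε ε₀ k W u 0 k t = 0 :=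
        interfaceForcing_eq_zero ε ε₀ W u (by omega) (by simp) t
      simp only [Fin.zero_eta, Fin.isValue]
      rw [hQ, hf, sub_self, zero_add]
      exact hasDerivAt_const t 0
    · have hval : quadTermOn shiftSetFlat ε₀ (mirrorTable ε ε) (W + truncFam k u) 1 k t
          - quadTermOn shiftSetFlat ε₀ (mirrorTable ε ε) W 1 k t + interfaceForcing ε ε₀ k W u 1 k t = 0 := by
        rw [interfaceForcing_bond]
        simp only [Fin.isValue, MirrorField.quadTermOn_mirrorTable_bond, hη_e, hη_ep, clock]
        ring
      simp only [Fin.mk_one, Fin.isValue]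
      rw [hval]
      exact hasDerivAt_const t 0
  · ----------------------------------------------------------------
    -- k ≥ e + 1: η = u there; the equation is the deviation equation plus the carrier interface term at k = e+1
    ----------------------------------------------------------------
    rw [truncFam_of_le (by omega : e + 1 ≤ k)]
    have hdev : ∀ (j : Fin 2) (k' : ℤ), HasDerivAt (u j k')
        (quadTermOn shiftSetFlat ε₀ (mirrorTable ε ε) (W + u) j k' t
          - quadTermOn shiftSetFlat ε₀ (mirrorTable ε ε) W j k' t) t := by
      intro j k'
      have h := (hX j k').sub (hW j k')
      have hfun : ((W + u) j k' - W j k') = u j k' := by funext s; simp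
      rwa [hfun] at h
    rcases lt_or_eq_of_le (show e + 1 ≤ k by omega) with hgt2 | heq1
    · -- k ≥ e + 2
      have hQ := quadTermOn_eq_of_eqOn_core ε₀ ε hagree i (show e + 2 ≤ k by omega)
      have hf : interfaceForcing ε ε₀ e W u i k t = 0 :=
        interfaceForcing_eq_zero ε ε₀ W u (by omega) (by omega) t
      rw [← hQ, hf, add_zero]
      exact hdev i k
    · subst heq1
      fin_cases i
      · -- the carrier at the interface shell
        have hint := quadTermOn_carrier_interface ε₀ ε hagree
        simp only [Fin.zero_eta, Fin.isValue]
        refine (hdev 0 (e + 1)).congr_deriv ?_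
        rw [interfaceForcing_carrier]
        have h1 : quadTermOn shiftSetFlat ε₀ (mirrorTable ε ε) (W + u) 0 (e + 1) t
            = quadTermOn shiftSetFlat ε₀ (mirrorTable ε ε) (W + truncFam e u) 0 (e + 1) t
              + clock ε₀ e * ((W + u) 1 e t - (W + truncFam e u) 1 e t)
                * ((W + u) 1 e t + (W + truncFam e u) 1 e t + ε * (W + u) 0 (e + 1) t) := by
          linarith [hint]
        rw [h1, hη_e]
        simp only [Pi.add_apply]
        ring
      · -- the bond at the interface shell reads shells e+1, e+2 only
        have hQ := quadTermOn_bond_eq_of_eqOn_core ε₀ ε hagree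
        have hf : interfaceForcing ε ε₀ e W u 1 (e + 1) t = 0 :=
          interfaceForcing_eq_zero ε ε₀ W u (by simp) (by omega) t
        simp only [Fin.mk_one, Fin.isValue]
        rw [← hQ, hf, add_zero]
        exact hdev 1 (e + 1)

/-! ### 4. First-order bounds and continuity -/

/-- **Carrier interface bound**: `|f₀,ₑ₊₁| ≤ c_e·|q_e|·(2|V_e| + |q_e| + ε(|A_{e+1}| + |p_{e+1}|))` (`0 ≤ ε`, `−1 ≤ ε₀`).
[cite: Tao2016AveragedNS, §4 (4.8); route TaoLadderRungTwoFlat, L8b-3 (LADDER §49.5 (b), κ_t)] -/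
theorem abs_interfaceForcing_carrier_le {ε ε₀ : ℝ} (hε : 0 ≤ ε) (hε₀ : -1 ≤ ε₀) (e : ℤ)
    (W u : Fin 2 → ℤ → ℝ → ℝ) (t : ℝ) :
    |interfaceForcing ε ε₀ e W u 0 (e + 1) t|
      ≤ clock ε₀ e * |u 1 e t| * (2 * |W 1 e t| + |u 1 e t| + ε * (|W 0 (e + 1) t| + |u 0 (e + 1) t|)) := by
  rw [interfaceForcing_carrier]
  have hc : 0 ≤ clock ε₀ e := by unfold clock; exact Real.rpow_nonneg (by linarith) _
  rw [abs_mul, abs_mul, abs_of_nonneg hc]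
  refine mul_le_mul_of_nonneg_left ?_ (mul_nonneg hc (abs_nonneg _))
  calc |2 * W 1 e t + u 1 e t + ε * (W 0 (e + 1) t + u 0 (e + 1) t)|
      ≤ |2 * W 1 e t| + |u 1 e t| + |ε * (W 0 (e + 1) t + u 0 (e + 1) t)| := abs_add_three _ _ _
    _ ≤ 2 * |W 1 e t| + |u 1 e t| + ε * (|W 0 (e + 1) t| + |u 0 (e + 1) t|) := by
        rw [abs_mul, abs_mul, abs_of_nonneg hε, abs_two]
        gcongr
        exact abs_add_le _ _

/-- **Bond bookkeeping bound**: `|f₁,ₑ| ≤ c_e·|p_{e+1}|·(|V_e| + ε(2|A_{e+1}| + |p_{e+1}|))` (`0 ≤ ε`, `−1 ≤ ε₀`).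
[cite: Tao2016AveragedNS, §4 (4.8); route TaoLadderRungTwoFlat, L8b-3 (LADDER §49.5 (b))] -/
theorem abs_interfaceForcing_bond_le {ε ε₀ : ℝ} (hε : 0 ≤ ε) (hε₀ : -1 ≤ ε₀) (e : ℤ)
    (W u : Fin 2 → ℤ → ℝ → ℝ) (t : ℝ) :
    |interfaceForcing ε ε₀ e W u 1 e t|
      ≤ clock ε₀ e * |u 0 (e + 1) t| * (|W 1 e t| + ε * (2 * |W 0 (e + 1) t| + |u 0 (e + 1) t|)) := by
  rw [interfaceForcing_bond]
  have hc : 0 ≤ clock ε₀ e := by unfold clock; exact Real.rpow_nonneg (by linarith) _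
  rw [abs_mul, abs_mul, abs_of_nonneg hc]
  refine mul_le_mul_of_nonneg_left ?_ (mul_nonneg hc (abs_nonneg _))
  calc |W 1 e t + ε * (2 * W 0 (e + 1) t + u 0 (e + 1) t)|
      ≤ |W 1 e t| + |ε * (2 * W 0 (e + 1) t + u 0 (e + 1) t)| := abs_add_le _ _
    _ ≤ |W 1 e t| + ε * (2 * |W 0 (e + 1) t| + |u 0 (e + 1) t|) := by
        rw [abs_mul, abs_of_nonneg hε]
        gcongr
        calc |2 * W 0 (e + 1) t + u 0 (e + 1) t| ≤ |2 * W 0 (e + 1) t| + |u 0 (e + 1) t| := abs_add_le _ _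
          _ = 2 * |W 0 (e + 1) t| + |u 0 (e + 1) t| := by rw [abs_mul, abs_two]

/-- A uniform bound on the whole forcing family from the two site bounds: if `|f₀,ₑ₊₁|, |f₁,ₑ| ≤ F` then
`|fᵢ,ₖ| ≤ F` everywhere (`F ≥ 0`). [cite: Tao2016AveragedNS, §4 (4.8); route TaoLadderRungTwoFlat, L8b-3] -/
theorem abs_interfaceForcing_le {ε ε₀ F : ℝ} {e : ℤ} {W u : Fin 2 → ℤ → ℝ → ℝ} {t : ℝ} (hF : 0 ≤ F)
    (h0 : |interfaceForcing ε ε₀ e W u 0 (e + 1) t| ≤ F) (h1 : |interfaceForcing ε ε₀ e W u 1 e t| ≤ F)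
    (i : Fin 2) (k : ℤ) : |interfaceForcing ε ε₀ e W u i k t| ≤ F := by
  by_cases ha : i = 0 ∧ k = e + 1
  · rw [ha.1, ha.2]; exact h0
  by_cases hb : i = 1 ∧ k = e
  · rw [hb.1, hb.2]; exact h1
  rw [interfaceForcing_eq_zero ε ε₀ W u ha hb t, abs_zero]
  exact hF

/-- The interface forcing is continuous in time when the template and the deviation are (at the three interface
values it reads). [cite: Tao2016AveragedNS, §4 (4.8); route TaoLadderRungTwoFlat, L8b-3] -/
theorem continuous_interfaceForcing {ε ε₀ : ℝ} {e : ℤ} {W u : Fin 2 → ℤ → ℝ → ℝ}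
    (hW : ∀ i k, Continuous (W i k)) (hu : ∀ i k, Continuous (u i k)) (i : Fin 2) (k : ℤ) :
    Continuous (interfaceForcing ε ε₀ e W u i k) := by
  by_cases ha : i = 0 ∧ k = e + 1
  · rw [ha.1, ha.2]
    have : interfaceForcing ε ε₀ e W u 0 (e + 1)
        = fun t => clock ε₀ e * u 1 e t * (2 * W 1 e t + u 1 e t + ε * (W 0 (e + 1) t + u 0 (e + 1) t)) := by
      funext t; exact interfaceForcing_carrier ε ε₀ e W u t
    rw [this]
    have := hW 1 e; have := hW 0 (e + 1); have := hu 1 e; have := hu 0 (e + 1)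
    fun_prop
  by_cases hb : i = 1 ∧ k = e
  · rw [hb.1, hb.2]
    have : interfaceForcing ε ε₀ e W u 1 e
        = fun t => clock ε₀ e * u 0 (e + 1) t * (W 1 e t + ε * (2 * W 0 (e + 1) t + u 0 (e + 1) t)) := by
      funext t; exact interfaceForcing_bond ε ε₀ e W u t
    rw [this]
    have := hW 1 e; have := hW 0 (e + 1); have := hu 0 (e + 1)
    fun_prop
  have : interfaceForcing ε ε₀ e W u i k = fun _ => 0 := by
    funext t; exact interfaceForcing_eq_zero ε ε₀ W u ha hb t
  rw [this]
  exact continuous_const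

end MirrorPulse

end Summit.NavierStokesRegularity.NavierStokesRegularity.Theorems

end
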